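import Summits.CriticalPhenomena.PercolationContinuityZ3.Theorems.Transplant.FKConnectivityAllQAntipodalTwoSumArith
import Summits.CriticalPhenomena.PercolationContinuityZ3.Theorems.Transplant.FKConnectivityAllQAntipodalOneSumClosure
import Summits.CriticalPhenomena.PercolationContinuityZ3.Theorems.Transplant.FKConnectivityAllQAntipodalMajTheta
import Summits.CriticalPhenomena.PercolationContinuityZ3.Theorems.Transplant.FKConnectivityAllQSPDualHost
import HarnessLib

/-!
# Connectivity correlation inequalities for `φ_{w,q}`, every `q > 0` — file 75b-ii: **THE SYMMETRISED `PQ` / `ED` HALVES OF THE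
# ODD / EVEN DECOMPOSITION ACROSS A 2-SEPARATION ARE INSTANCES ON THE THREE CELLS OF ONE BLOCK**

Support file (`--supports stmt-CriticalPhenomena-4575`), FK sub-lane `prim-bschramm-fk-2` (gen 33/34); builds on p205010 (kernel theorem,
internal audit signed; external expert review pending).  No definitions, no named facts, no sorries; standard axioms.

Fix one block `(M₁, C₁)` of a two-terminal gluing at `s ≠ t` (`st ∉ M₁`, `M₁ ∩ C₁ = ∅`) and freeze the other block's configuration: its level
`ℓ₂` and its type bits `A₂ = [s↔t on the γ₂-side]`, `B₂ = [s↔t on the complement side]`.  For test functions `f₁, g₁` depending only on the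
`M₁`-coordinates (`f₁` reading only `S'`, `g₁` blind to `S'`, both increasing) the symmetrised typed level indicator
`1{ℓ₁+ℓ₂+[a₁∧A₂]+[b₁∧B₂] ≤ m} + 1{ℓ₁+ℓ₂+[a₁∧B₂]+[b₁∧A₂] ≤ m}` times `f̂₁ ĝ₁` sums to `≤ 0` over `γ₁ ⊆ M₁`, GIVEN the levelwise
antipodal inequality on the three cells `(M₁, C₁)`, `(M₁, C₁ ∪ {st})`, `(M₁ ∪ {st}, C₁)`: according to the type `(A₂,B₂)` the sum is
twice an instance on the contracted cell (`FK.apExpC_insert_root_contract`), a full instance on the live cell (`FK.apExpC_insert_root_live₁/₂`),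
or twice an instance on the deleted cell — **`FK.twoSum_half₁_nonpos`**, and its mirror **`FK.twoSum_half₂_nonpos`** (block 2 varies,
block 1 frozen), used for the `PQ` and the `ED` terms of file 75b (`…TwoSumReduction`).
[cite: Grimmett2006, §3.8 Thm. (3.90) (pp. 61–62); §3.9 (pp. 63–64)] [cite: Wagner2006, Thm. 5.8(d), §5.3]
-/

noncomputable section

namespace Summit.CriticalPhenomena.PercolationContinuityZ3.Theorems

namespace FK

open SimpleGraph Literature.Probability.LatticeModels Literature.Probability.Percolation
open scoped Classical

variable {V : Type*} [Fintype V]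

/-- **Block 1 varies, block 2 frozen.**  See the module docstring. [cite: Grimmett2006, §3.8 Thm. (3.90) (pp. 61–62)] -/
theorem twoSum_half₁_nonpos {M₁ C₁ : Finset (Sym2 V)} {s t : V} (hMC₁ : Disjoint M₁ C₁) (hst₁ : s(s, t) ∉ M₁)
    (hA : ∀ M' C' : Finset (Sym2 V),
      (M' = M₁ ∧ C' = C₁) ∨ (M' = M₁ ∧ C' = insert s(s, t) C₁) ∨ (M' = insert s(s, t) M₁ ∧ C' = C₁) →
      ∀ S' : Finset (Sym2 V), ∀ f' g' : Finset (Sym2 V) → ℝ,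
      (∀ e : Sym2 V, e ∉ S' → ∀ A : Finset (Sym2 V), f' (insert e A) = f' A) →
      (∀ ⦃A B : Finset (Sym2 V)⦄, A ⊆ B → f' A ≤ f' B) →
      (∀ e ∈ S', ∀ A : Finset (Sym2 V), g' (insert e A) = g' A) →
      (∀ ⦃A B : Finset (Sym2 V)⦄, A ⊆ B → g' A ≤ g' B) → ∀ J' : ℕ,
      ∑ γ ∈ M'.powerset with apExpC M' C' γ ≤ J',
        (f' (γ ∪ C') - f' (M' \ γ ∪ C')) * (g' (γ ∪ C') - g' (M' \ γ ∪ C')) ≤ 0)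
    {S' : Finset (Sym2 V)} {f₁ g₁ : Finset (Sym2 V) → ℝ}
    (hf₁r : ∀ e : Sym2 V, e ∉ S' → ∀ A : Finset (Sym2 V), f₁ (insert e A) = f₁ A)
    (hf₁m : ∀ ⦃A B : Finset (Sym2 V)⦄, A ⊆ B → f₁ A ≤ f₁ B)
    (hg₁b : ∀ e ∈ S', ∀ A : Finset (Sym2 V), g₁ (insert e A) = g₁ A)
    (hg₁m : ∀ ⦃A B : Finset (Sym2 V)⦄, A ⊆ B → g₁ A ≤ g₁ B)
    (hf₁M : ∀ A : Finset (Sym2 V), f₁ A = f₁ (A ∩ M₁)) (hg₁M : ∀ A : Finset (Sym2 V), g₁ A = g₁ (A ∩ M₁))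
    (a₁ b₁ : Finset (Sym2 V) → Bool)
    (ha₁ : a₁ = fun γ₁ => decide ((openGraph (↑(γ₁ ∪ C₁) : BondConfig V)).Reachable s t))
    (hb₁ : b₁ = fun γ₁ => decide ((openGraph (↑(M₁ \ γ₁ ∪ C₁) : BondConfig V)).Reachable s t))
    (ℓ₂ m : ℕ) (A₂ B₂ : Bool) :
    ∑ γ₁ ∈ M₁.powerset,
      ((if apExpC M₁ C₁ γ₁ + ℓ₂ + (if a₁ γ₁ = true ∧ A₂ = true then 1 else 0) +
            (if b₁ γ₁ = true ∧ B₂ = true then 1 else 0) ≤ m then (1 : ℝ) else 0) +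
        (if apExpC M₁ C₁ γ₁ + ℓ₂ + (if a₁ γ₁ = true ∧ B₂ = true then 1 else 0) +
            (if b₁ γ₁ = true ∧ A₂ = true then 1 else 0) ≤ m then (1 : ℝ) else 0)) *
        ((f₁ γ₁ - f₁ (M₁ \ γ₁)) * (g₁ γ₁ - g₁ (M₁ \ γ₁))) ≤ 0 := by
  -- evaluation of `f₁, g₁` through `· ∩ M₁`
  have trM : ∀ γ₁ : Finset (Sym2 V), γ₁ ⊆ M₁ → ∀ X : Finset (Sym2 V), Disjoint M₁ X → (γ₁ ∪ X) ∩ M₁ = γ₁ := by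
    intro γ₁ hγ₁ X hX
    rw [Finset.union_inter_distrib_right, Finset.inter_eq_left.2 hγ₁, Finset.disjoint_iff_inter_eq_empty.1 hX.symm,
      Finset.union_empty]
  have hdC₁' : Disjoint M₁ (insert s(s, t) C₁) := Finset.disjoint_insert_right.2 ⟨hst₁, hMC₁⟩
  have trMi : ∀ Z : Finset (Sym2 V), Z ⊆ M₁ → (insert s(s, t) Z ∪ C₁) ∩ M₁ = Z := by
    intro Z hZ
    rw [Finset.insert_union, insert_inter_of_notMem' hst₁]
    exact trM Z hZ C₁ hMC₁
  have hF : ∀ X Y γ₁ : Finset (Sym2 V), X ∩ M₁ = γ₁ → Y ∩ M₁ = M₁ \ γ₁ →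
      (f₁ X - f₁ Y) * (g₁ X - g₁ Y) = (f₁ γ₁ - f₁ (M₁ \ γ₁)) * (g₁ γ₁ - g₁ (M₁ \ γ₁)) := by
    intro X Y γ₁ hX hY
    rw [hf₁M X, hf₁M Y, hg₁M X, hg₁M Y, hX, hY]
  -- the cell identities (`st ∉ M₁`)
  have cell_contract : ∀ γ₁ : Finset (Sym2 V), apExpC M₁ (insert s(s, t) C₁) γ₁ + 2 =
      apExpC M₁ C₁ γ₁ + (if a₁ γ₁ = true then 1 else 0) + (if b₁ γ₁ = true then 1 else 0) := by
    intro γ₁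
    have h := apExpC_insert_root_contract (M := M₁) (C := C₁) (γ := γ₁) (a := s) (b := t)
    simp only [ha₁, hb₁, decide_eq_true_eq]
    exact h
  have cell_live₁ : ∀ γ₁ : Finset (Sym2 V), apExpC (insert s(s, t) M₁) C₁ (insert s(s, t) γ₁) + 1 =
      apExpC M₁ C₁ γ₁ + (if a₁ γ₁ = true then 1 else 0) := by
    intro γ₁
    have h := apExpC_insert_root_live₁ (C := C₁) (γ := γ₁) hst₁
    simp only [ha₁, decide_eq_true_eq]
    exact h
  have cell_live₂ : ∀ γ₁ : Finset (Sym2 V), γ₁ ⊆ M₁ → apExpC (insert s(s, t) M₁) C₁ γ₁ + 1 =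
      apExpC M₁ C₁ γ₁ + (if b₁ γ₁ = true then 1 else 0) := by
    intro γ₁ hγ₁
    have h := apExpC_insert_root_live₂ (C := C₁) hst₁ hγ₁
    simp only [hb₁, decide_eq_true_eq]
    exact h
  haveI : Nonempty V := ⟨s⟩
  have one_le : ∀ M' C' γ : Finset (Sym2 V), 1 ≤ apExpC M' C' γ := fun M' C' γ => by
    unfold apExpC
    have h1 := one_le_clusterCount_of_nonempty (↑(γ ∪ C') : BondConfig V)
    omega
  -- the four types of the frozen block
  rcases Bool.eq_false_or_eq_true A₂ with ha | ha <;> rcases Bool.eq_false_or_eq_true B₂ with hb | hb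
  · -- type (1,1): the cell `(M₁, C₁ ∪ {st})` at cut-off `m - ℓ₂ - 2`
    have key := hA M₁ (insert s(s, t) C₁) (Or.inr (Or.inl ⟨rfl, rfl⟩)) S' f₁ g₁ hf₁r hf₁m hg₁b hg₁m (m - ℓ₂ - 2)
    rw [Finset.sum_filter] at key
    have e2 : ∑ γ₁ ∈ M₁.powerset,
        ((if apExpC M₁ C₁ γ₁ + ℓ₂ + (if a₁ γ₁ = true ∧ A₂ = true then 1 else 0) +
              (if b₁ γ₁ = true ∧ B₂ = true then 1 else 0) ≤ m then (1 : ℝ) else 0) +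
          (if apExpC M₁ C₁ γ₁ + ℓ₂ + (if a₁ γ₁ = true ∧ B₂ = true then 1 else 0) +
              (if b₁ γ₁ = true ∧ A₂ = true then 1 else 0) ≤ m then (1 : ℝ) else 0)) *
          ((f₁ γ₁ - f₁ (M₁ \ γ₁)) * (g₁ γ₁ - g₁ (M₁ \ γ₁))) =
        2 * ∑ γ₁ ∈ M₁.powerset, (if apExpC M₁ (insert s(s, t) C₁) γ₁ ≤ m - ℓ₂ - 2 then
          (f₁ (γ₁ ∪ insert s(s, t) C₁) - f₁ (M₁ \ γ₁ ∪ insert s(s, t) C₁)) *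
            (g₁ (γ₁ ∪ insert s(s, t) C₁) - g₁ (M₁ \ γ₁ ∪ insert s(s, t) C₁)) else 0) := by
      rw [Finset.mul_sum]
      refine Finset.sum_congr rfl fun γ₁ hγ₁ => ?_
      have hγ₁' : γ₁ ⊆ M₁ := Finset.mem_powerset.1 hγ₁
      rw [hF _ _ γ₁ (trM γ₁ hγ₁' _ hdC₁') (trM (M₁ \ γ₁) Finset.sdiff_subset _ hdC₁')]
      exact indPair_contract _ _ _ _ (a₁ γ₁) (b₁ γ₁) A₂ B₂ ha hb (cell_contract γ₁) (one_le _ _ _) _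
    rw [e2]
    exact mul_nonpos_of_nonneg_of_nonpos (by norm_num) key
  · -- type (1,0): the cell `(M₁ ∪ {st}, C₁)` at cut-off `m - ℓ₂ - 1`
    have key := hA (insert s(s, t) M₁) C₁ (Or.inr (Or.inr ⟨rfl, rfl⟩)) S' f₁ g₁ hf₁r hf₁m hg₁b hg₁m (m - ℓ₂ - 1)
    rw [Finset.sum_filter, Finset.sum_powerset_insert hst₁, ← Finset.sum_add_distrib] at key
    refine le_of_eq_of_le (Finset.sum_congr rfl fun γ₁ hγ₁ => ?_) key
    have hγ₁' : γ₁ ⊆ M₁ := Finset.mem_powerset.1 hγ₁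
    have hstγ : s(s, t) ∉ γ₁ := fun h => hst₁ (hγ₁' h)
    have r1 : insert s(s, t) M₁ \ γ₁ ∪ C₁ = insert s(s, t) (M₁ \ γ₁) ∪ C₁ := by
      rw [Finset.insert_sdiff_of_notMem M₁ hstγ]
    have r2 : insert s(s, t) M₁ \ insert s(s, t) γ₁ ∪ C₁ = M₁ \ γ₁ ∪ C₁ := by
      rw [Finset.insert_sdiff_insert, Finset.sdiff_insert_of_notMem hst₁]
    rw [r1, r2, hF (γ₁ ∪ C₁) (insert s(s, t) (M₁ \ γ₁) ∪ C₁) γ₁ (trM γ₁ hγ₁' C₁ hMC₁) (trMi (M₁ \ γ₁) Finset.sdiff_subset),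
      hF (insert s(s, t) γ₁ ∪ C₁) (M₁ \ γ₁ ∪ C₁) γ₁ (trMi γ₁ hγ₁') (trM (M₁ \ γ₁) Finset.sdiff_subset C₁ hMC₁)]
    exact indPair_live _ _ _ _ _ (a₁ γ₁) (b₁ γ₁) A₂ B₂ (Or.inl ⟨ha, hb⟩) (cell_live₁ γ₁) (cell_live₂ γ₁ hγ₁')
      (one_le _ _ _) (one_le _ _ _) _
  · -- type (0,1): the same cell
    have key := hA (insert s(s, t) M₁) C₁ (Or.inr (Or.inr ⟨rfl, rfl⟩)) S' f₁ g₁ hf₁r hf₁m hg₁b hg₁m (m - ℓ₂ - 1)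
    rw [Finset.sum_filter, Finset.sum_powerset_insert hst₁, ← Finset.sum_add_distrib] at key
    refine le_of_eq_of_le (Finset.sum_congr rfl fun γ₁ hγ₁ => ?_) key
    have hγ₁' : γ₁ ⊆ M₁ := Finset.mem_powerset.1 hγ₁
    have hstγ : s(s, t) ∉ γ₁ := fun h => hst₁ (hγ₁' h)
    have r1 : insert s(s, t) M₁ \ γ₁ ∪ C₁ = insert s(s, t) (M₁ \ γ₁) ∪ C₁ := by
      rw [Finset.insert_sdiff_of_notMem M₁ hstγ]
    have r2 : insert s(s, t) M₁ \ insert s(s, t) γ₁ ∪ C₁ = M₁ \ γ₁ ∪ C₁ := by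
      rw [Finset.insert_sdiff_insert, Finset.sdiff_insert_of_notMem hst₁]
    rw [r1, r2, hF (γ₁ ∪ C₁) (insert s(s, t) (M₁ \ γ₁) ∪ C₁) γ₁ (trM γ₁ hγ₁' C₁ hMC₁) (trMi (M₁ \ γ₁) Finset.sdiff_subset),
      hF (insert s(s, t) γ₁ ∪ C₁) (M₁ \ γ₁ ∪ C₁) γ₁ (trMi γ₁ hγ₁') (trM (M₁ \ γ₁) Finset.sdiff_subset C₁ hMC₁)]
    exact indPair_live _ _ _ _ _ (a₁ γ₁) (b₁ γ₁) A₂ B₂ (Or.inr ⟨ha, hb⟩) (cell_live₁ γ₁) (cell_live₂ γ₁ hγ₁')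
      (one_le _ _ _) (one_le _ _ _) _
  · -- type (0,0): the cell `(M₁, C₁)` at cut-off `m - ℓ₂`
    have key := hA M₁ C₁ (Or.inl ⟨rfl, rfl⟩) S' f₁ g₁ hf₁r hf₁m hg₁b hg₁m (m - ℓ₂)
    rw [Finset.sum_filter] at key
    have e2 : ∑ γ₁ ∈ M₁.powerset,
        ((if apExpC M₁ C₁ γ₁ + ℓ₂ + (if a₁ γ₁ = true ∧ A₂ = true then 1 else 0) +
              (if b₁ γ₁ = true ∧ B₂ = true then 1 else 0) ≤ m then (1 : ℝ) else 0) +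
          (if apExpC M₁ C₁ γ₁ + ℓ₂ + (if a₁ γ₁ = true ∧ B₂ = true then 1 else 0) +
              (if b₁ γ₁ = true ∧ A₂ = true then 1 else 0) ≤ m then (1 : ℝ) else 0)) *
          ((f₁ γ₁ - f₁ (M₁ \ γ₁)) * (g₁ γ₁ - g₁ (M₁ \ γ₁))) =
        2 * ∑ γ₁ ∈ M₁.powerset, (if apExpC M₁ C₁ γ₁ ≤ m - ℓ₂ then
          (f₁ (γ₁ ∪ C₁) - f₁ (M₁ \ γ₁ ∪ C₁)) * (g₁ (γ₁ ∪ C₁) - g₁ (M₁ \ γ₁ ∪ C₁)) else 0) := by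
      rw [Finset.mul_sum]
      refine Finset.sum_congr rfl fun γ₁ hγ₁ => ?_
      have hγ₁' : γ₁ ⊆ M₁ := Finset.mem_powerset.1 hγ₁
      rw [hF _ _ γ₁ (trM γ₁ hγ₁' _ hMC₁) (trM (M₁ \ γ₁) Finset.sdiff_subset _ hMC₁)]
      exact indPair_del _ _ _ (a₁ γ₁) (b₁ γ₁) A₂ B₂ ha hb (one_le _ _ _) _
    rw [e2]
    exact mul_nonpos_of_nonneg_of_nonpos (by norm_num) key

/-- **Block 2 varies, block 1 frozen** (mirror of `twoSum_half₁_nonpos`; the frozen bits come first inside the conjunctions and the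
frozen level first in the sum, as produced by the expansion of file 75b). [cite: Grimmett2006, §3.8 Thm. (3.90) (pp. 61–62)] -/
theorem twoSum_half₂_nonpos {M₂ C₂ : Finset (Sym2 V)} {s t : V} (hMC₂ : Disjoint M₂ C₂) (hst₂ : s(s, t) ∉ M₂)
    (hB : ∀ M' C' : Finset (Sym2 V),
      (M' = M₂ ∧ C' = C₂) ∨ (M' = M₂ ∧ C' = insert s(s, t) C₂) ∨ (M' = insert s(s, t) M₂ ∧ C' = C₂) →
      ∀ S' : Finset (Sym2 V), ∀ f' g' : Finset (Sym2 V) → ℝ,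
      (∀ e : Sym2 V, e ∉ S' → ∀ A : Finset (Sym2 V), f' (insert e A) = f' A) →
      (∀ ⦃A B : Finset (Sym2 V)⦄, A ⊆ B → f' A ≤ f' B) →
      (∀ e ∈ S', ∀ A : Finset (Sym2 V), g' (insert e A) = g' A) →
      (∀ ⦃A B : Finset (Sym2 V)⦄, A ⊆ B → g' A ≤ g' B) → ∀ J' : ℕ,
      ∑ γ ∈ M'.powerset with apExpC M' C' γ ≤ J',
        (f' (γ ∪ C') - f' (M' \ γ ∪ C')) * (g' (γ ∪ C') - g' (M' \ γ ∪ C')) ≤ 0)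
    {S' : Finset (Sym2 V)} {f₂ g₂ : Finset (Sym2 V) → ℝ}
    (hf₂r : ∀ e : Sym2 V, e ∉ S' → ∀ A : Finset (Sym2 V), f₂ (insert e A) = f₂ A)
    (hf₂m : ∀ ⦃A B : Finset (Sym2 V)⦄, A ⊆ B → f₂ A ≤ f₂ B)
    (hg₂b : ∀ e ∈ S', ∀ A : Finset (Sym2 V), g₂ (insert e A) = g₂ A)
    (hg₂m : ∀ ⦃A B : Finset (Sym2 V)⦄, A ⊆ B → g₂ A ≤ g₂ B)
    (hf₂M : ∀ A : Finset (Sym2 V), f₂ A = f₂ (A ∩ M₂)) (hg₂M : ∀ A : Finset (Sym2 V), g₂ A = g₂ (A ∩ M₂))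
    (a₂ b₂ : Finset (Sym2 V) → Bool)
    (ha₂ : a₂ = fun γ₂ => decide ((openGraph (↑(γ₂ ∪ C₂) : BondConfig V)).Reachable s t))
    (hb₂ : b₂ = fun γ₂ => decide ((openGraph (↑(M₂ \ γ₂ ∪ C₂) : BondConfig V)).Reachable s t))
    (ℓ₁ m : ℕ) (A₁ B₁ : Bool) :
    ∑ γ₂ ∈ M₂.powerset,
      ((if ℓ₁ + apExpC M₂ C₂ γ₂ + (if A₁ = true ∧ a₂ γ₂ = true then 1 else 0) +
            (if B₁ = true ∧ b₂ γ₂ = true then 1 else 0) ≤ m then (1 : ℝ) else 0) +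
        (if ℓ₁ + apExpC M₂ C₂ γ₂ + (if B₁ = true ∧ a₂ γ₂ = true then 1 else 0) +
            (if A₁ = true ∧ b₂ γ₂ = true then 1 else 0) ≤ m then (1 : ℝ) else 0)) *
        ((f₂ γ₂ - f₂ (M₂ \ γ₂)) * (g₂ γ₂ - g₂ (M₂ \ γ₂))) ≤ 0 := by
  have trN : ∀ γ₂ : Finset (Sym2 V), γ₂ ⊆ M₂ → ∀ X : Finset (Sym2 V), Disjoint M₂ X → (γ₂ ∪ X) ∩ M₂ = γ₂ := by
    intro γ₂ hγ₂ X hX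
    rw [Finset.union_inter_distrib_right, Finset.inter_eq_left.2 hγ₂, Finset.disjoint_iff_inter_eq_empty.1 hX.symm,
      Finset.union_empty]
  have hdC₂' : Disjoint M₂ (insert s(s, t) C₂) := Finset.disjoint_insert_right.2 ⟨hst₂, hMC₂⟩
  have trNi : ∀ Z : Finset (Sym2 V), Z ⊆ M₂ → (insert s(s, t) Z ∪ C₂) ∩ M₂ = Z := by
    intro Z hZ
    rw [Finset.insert_union, insert_inter_of_notMem' hst₂]
    exact trN Z hZ C₂ hMC₂
  have hF : ∀ X Y γ₂ : Finset (Sym2 V), X ∩ M₂ = γ₂ → Y ∩ M₂ = M₂ \ γ₂ →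
      (f₂ X - f₂ Y) * (g₂ X - g₂ Y) = (f₂ γ₂ - f₂ (M₂ \ γ₂)) * (g₂ γ₂ - g₂ (M₂ \ γ₂)) := by
    intro X Y γ₂ hX hY
    rw [hf₂M X, hf₂M Y, hg₂M X, hg₂M Y, hX, hY]
  have cell_contract : ∀ γ₂ : Finset (Sym2 V), apExpC M₂ (insert s(s, t) C₂) γ₂ + 2 =
      apExpC M₂ C₂ γ₂ + (if a₂ γ₂ = true then 1 else 0) + (if b₂ γ₂ = true then 1 else 0) := by
    intro γ₂
    have h := apExpC_insert_root_contract (M := M₂) (C := C₂) (γ := γ₂) (a := s) (b := t)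
    simp only [ha₂, hb₂, decide_eq_true_eq]
    exact h
  have cell_live₁ : ∀ γ₂ : Finset (Sym2 V), apExpC (insert s(s, t) M₂) C₂ (insert s(s, t) γ₂) + 1 =
      apExpC M₂ C₂ γ₂ + (if a₂ γ₂ = true then 1 else 0) := by
    intro γ₂
    have h := apExpC_insert_root_live₁ (C := C₂) (γ := γ₂) hst₂
    simp only [ha₂, decide_eq_true_eq]
    exact h
  have cell_live₂ : ∀ γ₂ : Finset (Sym2 V), γ₂ ⊆ M₂ → apExpC (insert s(s, t) M₂) C₂ γ₂ + 1 =
      apExpC M₂ C₂ γ₂ + (if b₂ γ₂ = true then 1 else 0) := by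
    intro γ₂ hγ₂
    have h := apExpC_insert_root_live₂ (C := C₂) hst₂ hγ₂
    simp only [hb₂, decide_eq_true_eq]
    exact h
  haveI : Nonempty V := ⟨s⟩
  have one_le : ∀ M' C' γ : Finset (Sym2 V), 1 ≤ apExpC M' C' γ := fun M' C' γ => by
    unfold apExpC
    have h1 := one_le_clusterCount_of_nonempty (↑(γ ∪ C') : BondConfig V)
    omega
  rcases Bool.eq_false_or_eq_true A₁ with ha | ha <;> rcases Bool.eq_false_or_eq_true B₁ with hb | hb
  · -- type (1,1): cell `(M₂, C₂ ∪ {st})`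
    have key := hB M₂ (insert s(s, t) C₂) (Or.inr (Or.inl ⟨rfl, rfl⟩)) S' f₂ g₂ hf₂r hf₂m hg₂b hg₂m (m - ℓ₁ - 2)
    rw [Finset.sum_filter] at key
    have e2 : ∑ γ₂ ∈ M₂.powerset,
        ((if ℓ₁ + apExpC M₂ C₂ γ₂ + (if A₁ = true ∧ a₂ γ₂ = true then 1 else 0) +
              (if B₁ = true ∧ b₂ γ₂ = true then 1 else 0) ≤ m then (1 : ℝ) else 0) +
          (if ℓ₁ + apExpC M₂ C₂ γ₂ + (if B₁ = true ∧ a₂ γ₂ = true then 1 else 0) +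
              (if A₁ = true ∧ b₂ γ₂ = true then 1 else 0) ≤ m then (1 : ℝ) else 0)) *
          ((f₂ γ₂ - f₂ (M₂ \ γ₂)) * (g₂ γ₂ - g₂ (M₂ \ γ₂))) =
        2 * ∑ γ₂ ∈ M₂.powerset, (if apExpC M₂ (insert s(s, t) C₂) γ₂ ≤ m - ℓ₁ - 2 then
          (f₂ (γ₂ ∪ insert s(s, t) C₂) - f₂ (M₂ \ γ₂ ∪ insert s(s, t) C₂)) *
            (g₂ (γ₂ ∪ insert s(s, t) C₂) - g₂ (M₂ \ γ₂ ∪ insert s(s, t) C₂)) else 0) := by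
      rw [Finset.mul_sum]
      refine Finset.sum_congr rfl fun γ₂ hγ₂ => ?_
      have hγ₂' : γ₂ ⊆ M₂ := Finset.mem_powerset.1 hγ₂
      rw [hF _ _ γ₂ (trN γ₂ hγ₂' _ hdC₂') (trN (M₂ \ γ₂) Finset.sdiff_subset _ hdC₂')]
      exact indPair_contract₂ _ _ _ _ A₁ B₁ (a₂ γ₂) (b₂ γ₂) ha hb (cell_contract γ₂) (one_le _ _ _) _
    rw [e2]
    exact mul_nonpos_of_nonneg_of_nonpos (by norm_num) key
  · -- type (1,0): cell `(M₂ ∪ {st}, C₂)`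
    have key := hB (insert s(s, t) M₂) C₂ (Or.inr (Or.inr ⟨rfl, rfl⟩)) S' f₂ g₂ hf₂r hf₂m hg₂b hg₂m (m - ℓ₁ - 1)
    rw [Finset.sum_filter, Finset.sum_powerset_insert hst₂, ← Finset.sum_add_distrib] at key
    refine le_of_eq_of_le (Finset.sum_congr rfl fun γ₂ hγ₂ => ?_) key
    have hγ₂' : γ₂ ⊆ M₂ := Finset.mem_powerset.1 hγ₂
    have hstγ : s(s, t) ∉ γ₂ := fun h => hst₂ (hγ₂' h)
    have r1 : insert s(s, t) M₂ \ γ₂ ∪ C₂ = insert s(s, t) (M₂ \ γ₂) ∪ C₂ := by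
      rw [Finset.insert_sdiff_of_notMem M₂ hstγ]
    have r2 : insert s(s, t) M₂ \ insert s(s, t) γ₂ ∪ C₂ = M₂ \ γ₂ ∪ C₂ := by
      rw [Finset.insert_sdiff_insert, Finset.sdiff_insert_of_notMem hst₂]
    rw [r1, r2, hF (γ₂ ∪ C₂) (insert s(s, t) (M₂ \ γ₂) ∪ C₂) γ₂ (trN γ₂ hγ₂' C₂ hMC₂) (trNi (M₂ \ γ₂) Finset.sdiff_subset),
      hF (insert s(s, t) γ₂ ∪ C₂) (M₂ \ γ₂ ∪ C₂) γ₂ (trNi γ₂ hγ₂') (trN (M₂ \ γ₂) Finset.sdiff_subset C₂ hMC₂)]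
    exact indPair_live₂ _ _ _ _ _ A₁ B₁ (a₂ γ₂) (b₂ γ₂) (Or.inl ⟨ha, hb⟩) (cell_live₁ γ₂) (cell_live₂ γ₂ hγ₂')
      (one_le _ _ _) (one_le _ _ _) _
  · -- type (0,1): the same cell
    have key := hB (insert s(s, t) M₂) C₂ (Or.inr (Or.inr ⟨rfl, rfl⟩)) S' f₂ g₂ hf₂r hf₂m hg₂b hg₂m (m - ℓ₁ - 1)
    rw [Finset.sum_filter, Finset.sum_powerset_insert hst₂, ← Finset.sum_add_distrib] at key
    refine le_of_eq_of_le (Finset.sum_congr rfl fun γ₂ hγ₂ => ?_) key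
    have hγ₂' : γ₂ ⊆ M₂ := Finset.mem_powerset.1 hγ₂
    have hstγ : s(s, t) ∉ γ₂ := fun h => hst₂ (hγ₂' h)
    have r1 : insert s(s, t) M₂ \ γ₂ ∪ C₂ = insert s(s, t) (M₂ \ γ₂) ∪ C₂ := by
      rw [Finset.insert_sdiff_of_notMem M₂ hstγ]
    have r2 : insert s(s, t) M₂ \ insert s(s, t) γ₂ ∪ C₂ = M₂ \ γ₂ ∪ C₂ := by
      rw [Finset.insert_sdiff_insert, Finset.sdiff_insert_of_notMem hst₂]
    rw [r1, r2, hF (γ₂ ∪ C₂) (insert s(s, t) (M₂ \ γ₂) ∪ C₂) γ₂ (trN γ₂ hγ₂' C₂ hMC₂) (trNi (M₂ \ γ₂) Finset.sdiff_subset),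
      hF (insert s(s, t) γ₂ ∪ C₂) (M₂ \ γ₂ ∪ C₂) γ₂ (trNi γ₂ hγ₂') (trN (M₂ \ γ₂) Finset.sdiff_subset C₂ hMC₂)]
    exact indPair_live₂ _ _ _ _ _ A₁ B₁ (a₂ γ₂) (b₂ γ₂) (Or.inr ⟨ha, hb⟩) (cell_live₁ γ₂) (cell_live₂ γ₂ hγ₂')
      (one_le _ _ _) (one_le _ _ _) _
  · -- type (0,0): cell `(M₂, C₂)`
    have key := hB M₂ C₂ (Or.inl ⟨rfl, rfl⟩) S' f₂ g₂ hf₂r hf₂m hg₂b hg₂m (m - ℓ₁)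
    rw [Finset.sum_filter] at key
    have e2 : ∑ γ₂ ∈ M₂.powerset,
        ((if ℓ₁ + apExpC M₂ C₂ γ₂ + (if A₁ = true ∧ a₂ γ₂ = true then 1 else 0) +
              (if B₁ = true ∧ b₂ γ₂ = true then 1 else 0) ≤ m then (1 : ℝ) else 0) +
          (if ℓ₁ + apExpC M₂ C₂ γ₂ + (if B₁ = true ∧ a₂ γ₂ = true then 1 else 0) +
              (if A₁ = true ∧ b₂ γ₂ = true then 1 else 0) ≤ m then (1 : ℝ) else 0)) *
          ((f₂ γ₂ - f₂ (M₂ \ γ₂)) * (g₂ γ₂ - g₂ (M₂ \ γ₂))) =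
        2 * ∑ γ₂ ∈ M₂.powerset, (if apExpC M₂ C₂ γ₂ ≤ m - ℓ₁ then
          (f₂ (γ₂ ∪ C₂) - f₂ (M₂ \ γ₂ ∪ C₂)) * (g₂ (γ₂ ∪ C₂) - g₂ (M₂ \ γ₂ ∪ C₂)) else 0) := by
      rw [Finset.mul_sum]
      refine Finset.sum_congr rfl fun γ₂ hγ₂ => ?_
      have hγ₂' : γ₂ ⊆ M₂ := Finset.mem_powerset.1 hγ₂
      rw [hF _ _ γ₂ (trN γ₂ hγ₂' _ hMC₂) (trN (M₂ \ γ₂) Finset.sdiff_subset _ hMC₂)]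
      exact indPair_del₂ _ _ _ A₁ B₁ (a₂ γ₂) (b₂ γ₂) ha hb (one_le _ _ _) _
    rw [e2]
    exact mul_nonpos_of_nonneg_of_nonpos (by norm_num) key

end FK

end Summit.CriticalPhenomena.PercolationContinuityZ3.Theorems

end
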